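import Literature.IUT.HodgeArakelov.GMonoidFrobenioidsDef38Proofs
import Literature.AlgebraicGeometry.Frobenioids.PerfectionGroupification
import Literature.AlgebraicGeometry.Frobenioids.ModelFrobenioidMap
import Literature.AnabelianGeometry.EtaleTheta.PerfectionPrimes
import HarnessLib

/-!
# [IUTchII] Definition 3.8 (i) «whose divisor monoid associates to every object … a monoid isomorphic to `ℚ_{≥0}`»:
# the PERFECTED model Frobenioid of a `G`-monoid (`Φ^pf`, `B^pf`, `Div_B^pf`) and «`≅ ℕ` ⇒ pf `≅ ℚ_{≥0}`» objectwise

S. Mochizuki, *Inter-universal Teichmüller theory II*, §3, kurims manuscript (Dec. 2020), Definition 3.8 (i) p. 113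
l. 2–13: «gives rise to a `p_v`-adic Frobenioid of monoid type `ℤ` [cf. [FrdII], Example 1.1, (ii)] `F_cns(M^Θ_*)`;
`F_{†C_v}` whose divisor monoid associates to every object of `B^temp(Π_X(M^Θ_*))⁰` a monoid isomorphic to `ℚ_{≥0}`»
[cite: Mochizuki2012, Def 3.8 (i) p.113] (pages = kurims render IUTchII-kurims-url-5036b4059555; D-0012 claim key,
status disputed — nothing of the series is asserted).  S. Mochizuki, *The geometry of Frobenioids I*, Kyushu J. Math.
**62** (2008), §0 p. 11 «`M^pf`», Def. 1.1 (ii) p. 19 «`Φ^pf`», Prop. 5.3 p. 103 «`(C^un-tr)^pf` … the model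
Frobenioid of `(Φ^pf, (Φ^birat)^pf)`» [cite: MochizukiFrdI2008, Prop. 5.3 p.103].

abc-iut cell, MERGE-MAP row **R-Def38-a (i) PERF** (L6-lead gen 5 §F v1.19bc (2) «GO L6-t7 PERF», FREEZE-L6 row
X-L6t7-GMFP), seat abc-iut-L6-t7 (gen 4).  DEF NEW post-freeze additive, class (b) construction over FROZEN vocabulary
consumed BY NAME (nothing re-declared): abc-iut-w4-d019's (A) `CoveringMonoid.divisorFunctor / ratFnFunctor / divB /
frobenioid / ofStable` (p455796) and (B) `exists_associates_invariants_equiv_nat` (p457550), abc-iut-L1's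
`perfectionFunctor` / `toPerfectionFunctor` / `divPerfection` / `divPerfection_app_of` / `ModelFrobenioid.DataHom` /
`DataHom.functor` / `IsZMonoprime` / `IsQMonoprime` ([FrdI] §0, Def 1.1 (ii), Prop 5.3), and
`PerfectionPrimes.nonempty_perfection_congr` / `isQMonoprime_perfection_nat` (`(ℤ_{≥0})^pf ≅ ℚ_{≥0}`).

WHAT IS CONSTRUCTED / PROVED (for a `G`-monoid `M : CoveringMonoid G` over the small base `CosetCat G`):
* `divisorFunctorPf M := Φ^pf`, `ratFnFunctorPf M := B^pf`, **`divBPf M : B^pf ⟶ (Φ^pf)^gp`** (abc-iut-L1's `divPerfection`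
  of `Div_B`), **`frobenioidPf M := ModelFrobenioid Φ^pf B^pf Div_B^pf`** — the model Frobenioid of the PERFECTED data
  ([FrdI] Prop 5.3's description of `(C^un-tr)^pf`; the referent of print's «divisor monoid ≅ ℚ_{≥0}» reading of
  `F_cns`); `toPerfectionDataHom` / **`toFrobenioidPf : M.frobenioid ⥤ M.frobenioidPf`** («the functors that arise
  naturally from the construction of the perfection», `DataHom.functor` of `(Φ → Φ^pf, B → B^pf)`);
* **`isQMonoprime_perfection_of_isZMonoprime`** (`S ≅ ℤ_{≥0} ⇒ S^pf ≅ ℚ_{≥0}`) and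
  **`isQMonoprime_divisorFunctorPf_obj`**: at every object `G/U` where `Φ(G/U) ≅ ℤ_{≥0}`, `Φ^pf(G/U) ≅ ℚ_{≥0}`;
* **`isQMonoprime_divisorFunctorPf_ofStable_split`**: for the split `G`-monoid `U·θ^ℕ` of abc-iut-w4-d019's (B) (the shape
  of `Ψ_cns`'s and the theta monoids' stages; «`≅ ℕ` at EVERY object», p457550), the perfected divisor monoid is `≅ ℚ_{≥0}`
  at EVERY object of `CosetCat G` — print's clause, at the monoid level.
HONEST LIMITS: that `frobenioidPf` IS «the» perfection `C^pf` of [FrdI] Def 3.1 (iii) is [FrdI] Prop 5.5 (iv)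
(abc-iut-L1's `PfCompare.pfFunctor`, under `ModelFrobenioid.Hypotheses` + `IsPerfectedDiv`) — cited, not re-proved
here; the GENUINE-producer instance (`Φ(G_v/U) ≅ ord(𝒪^▷_{Ω^U}) ≅ ℤ_{≥0}` via `GaloisValDatum.divisorEquiv`, p459689, and
L1's `IsPadicLocal.isZMonoprime_ordInt`) is a separate proof-only corollary once that junction lands.  No `instance`, no
`Prop`-valued definition, no sorry; typed ≠ proved; nothing here bears on [IUTchIII] Cor. 3.12.

v2 ADDENDUM (append-only; v1 declarations byte-identical) — PRECISION on which perfected data is print's: [FrdII] Ex. 1.1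
(ii) as used by [IUTchI] Ex. 3.3 (i) («where we take “Λ” to be `ℤ`»; abc-iut-L1-t4's `PadicFrd.Datum.perf`, `Φ_{C_v}(Spec L) =
ord(𝒪^▷_L)^pf`, `B(Spec L) = L^×`) perfects the DIVISOR monoid only and keeps the rational-function monoid; so the
print-faithful monoid-level referent of Def 3.8 (i)'s `F_cns` («monoid type `ℤ`» AND «divisor monoid ≅ ℚ_{≥0}») is the model
Frobenioid of `(Φ^pf, B, Div_B ≫ (Φ → Φ^pf)^gp)` — **`frobenioidQ`** below (`divBQ`, `toFrobenioidQ`, `frobenioidQToPf`),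
sitting between `frobenioid` and `frobenioidPf` (`(Φ, B) → (Φ^pf, B) → (Φ^pf, B^pf)`, two `DataHom.functor`s whose composite
is the data of `toFrobenioidPf`); v1's `frobenioidPf` (B perfected as well) is the FULLY perfected data, and [FrdI] Prop 5.3's
`(C^un-tr)^pf` is its unit-trivialised variant — v1's docstring sentence «Prop 5.3's description of `(C^un-tr)^pf`» on
`frobenioidPf` should be read with this precision.  The «≅ ℚ_{≥0}» theorems of §2 concern `Φ^pf` alone and serve all three.
-/

noncomputable section

namespace Literature.IUT.HodgeArakelov

open CategoryTheory Opposite Literature.AlgebraicGeometry.Frobenioids Literature.AnabelianGeometry.SemiGraphs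

universe u v

namespace CoveringMonoid

variable {G : Type u} [Group G] [TopologicalSpace G] (M : CoveringMonoid.{u, v} G)

/-! ### 1. The perfected data `(Φ^pf, B^pf, Div_B^pf)` and the perfected model Frobenioid -/

/-- **`Φ^pf : G/U ↦ (Ψ^U/(Ψ^U)^×)^pf`**, the perfected divisor monoid ([FrdI] Def 1.1 (ii) `Φ^pf`, abc-iut-L1's
`perfectionFunctor`). [cite: MochizukiFrdI2008, Prop. 5.3 p.103] -/
abbrev divisorFunctorPf : (CosetCat G)ᵒᵖ ⥤ CommMonCat.{v} := perfectionFunctor M.divisorFunctor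

/-- **`B^pf : G/U ↦ ((Ψ^U)^gp)^pf`**, the perfected rational-function monoid. [cite: MochizukiFrdI2008, Prop. 5.3 p.103] -/
abbrev ratFnFunctorPf : (CosetCat G)ᵒᵖ ⥤ CommMonCat.{v} := perfectionFunctor M.ratFnFunctor

/-- **`Div_B^pf : B^pf ⟶ (Φ^pf)^gp`** — abc-iut-L1's `divPerfection` (`Div_B^pf` followed by the interchange
`(Φ^gp)^pf → (Φ^pf)^gp`) of the `G`-monoid's `Div_B`. [cite: MochizukiFrdI2008, Prop. 5.3 p.103] -/
def divBPf : M.ratFnFunctorPf ⟶ monoidGp M.divisorFunctorPf :=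
  divPerfection (Φ := M.divisorFunctor) (B := M.ratFnFunctor) M.divB

/-- `Div_B^pf` on `[b]` (`b ∈ B(G/U)`): `[b] ↦ ι^gp (Div_B b)`. [cite: MochizukiFrdI2008, Prop. 5.3 p.103] -/
theorem divBPf_app_of (X : (CosetCat G)ᵒᵖ) (b : M.ratFnFunctor.obj X) :
    (M.divBPf.app X).hom (Perfection.of _ b) =
      gpMap (Perfection.of (M.divisorFunctor.obj X)) ((M.divB.app X).hom b) :=
  divPerfection_app_of (Φ := M.divisorFunctor) (B := M.ratFnFunctor) M.divB X b

/-- **The perfected model Frobenioid `F^pf(G ↷ Ψ)`** of the `G`-monoid: [FrdI] Thm 5.2 (i)'s category of the perfected data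
`(Φ^pf, B^pf, Div_B^pf)` — [FrdI] Prop 5.3's description of `(C^un-tr)^pf`, the referent of [IUTchII] Def 3.8 (i)'s
«`p_v`-adic Frobenioid … whose divisor monoid associates to every object … a monoid isomorphic to `ℚ_{≥0}`» for
`F_cns(M^Θ_*)` at the monoid level. [cite: Mochizuki2012, Def 3.8 (i) p.113] -/
abbrev frobenioidPf : Type (max u v) := ModelFrobenioid M.divisorFunctorPf M.ratFnFunctorPf M.divBPf

/-- **The morphism of model data `(Φ, B, Div_B) → (Φ^pf, B^pf, Div_B^pf)`** (`Φ → Φ^pf`, `B → B^pf`, abc-iut-L1's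
`toPerfectionFunctor`; the square commutes by `divPerfection_app_of`). [cite: MochizukiFrdI2008, Prop. 5.3 p.103] -/
def toPerfectionDataHom : ModelFrobenioid.DataHom M.divB M.divBPf where
  η := toPerfectionFunctor M.divisorFunctor
  β := toPerfectionFunctor M.ratFnFunctor
  comm A u := by
    change MonGp.map (Perfection.of (M.divisorFunctor.obj A)) ((M.divB.app A).hom u) =
      (M.divBPf.app A).hom (Perfection.of _ u)
    rw [divBPf_app_of]
    rfl

/-- **`F(G ↷ Ψ) ⥤ F^pf(G ↷ Ψ)`**: the functor to the perfected model Frobenioid («the functors that arise naturally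
from the construction of the … perfection», [FrdI] Prop 5.3; abc-iut-L1's `DataHom.functor`).
[cite: MochizukiFrdI2008, Prop. 5.3 p.103] -/
def toFrobenioidPf : M.frobenioid ⥤ M.frobenioidPf := M.toPerfectionDataHom.functor

/-- `toFrobenioidPf` lies over the identity of `CosetCat G`. [cite: MochizukiFrdI2008, Prop. 5.3 p.103] -/
theorem toFrobenioidPf_obj_base (X : M.frobenioid) : (M.toFrobenioidPf.obj X).base = X.base := rfl

/-- The perfected model Frobenioid is inhabited (`(G/G, 0)`). [cite: Mochizuki2012, Def 3.8 (i) p.113] -/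
theorem nonempty_frobenioidPf : Nonempty M.frobenioidPf := ⟨⟨CosetCat.top, 1⟩⟩

/-! ### 2. «`≅ ℕ`» at an object ⇒ «`≅ ℚ_{≥0}`» for the perfected divisor monoid at that object -/

omit [TopologicalSpace G] in
/-- `S ≅ ℤ_{≥0}` ⇒ `S^pf ≅ ℚ_{≥0}` ([FrdI] §0 p. 11: `(ℤ_{≥0})^pf ≅ ℚ_{≥0}`; transport along abc-iut-L2's cross-universe
`nonempty_perfection_congr`). [cite: MochizukiFrdI2008, §0 p.11] -/
theorem isQMonoprime_perfection_of_isZMonoprime {S : Type v} [CommMonoid S] (hS : IsZMonoprime S) :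
    IsQMonoprime (Perfection S) := by
  obtain ⟨⟨e⟩⟩ := hS
  obtain ⟨e'⟩ := AnabelianGeometry.EtaleTheta.PerfectionPrimes.nonempty_perfection_congr e
  obtain ⟨⟨e₁⟩⟩ := AnabelianGeometry.EtaleTheta.PerfectionPrimes.isQMonoprime_perfection_nat
  exact ⟨⟨e'.trans e₁⟩⟩

/-- **«a monoid isomorphic to `ℚ_{≥0}`» at an object**: if the divisor monoid `Φ(G/U) = Ψ^U/(Ψ^U)^×` is `≅ ℤ_{≥0}` (the
«`≅ ℕ`» of Def 3.8 (ii), abc-iut-w4-d019's (B)), then the perfected divisor monoid `Φ^pf(G/U)` is `≅ ℚ_{≥0}`.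
[cite: Mochizuki2012, Def 3.8 (i) p.113] -/
theorem isQMonoprime_divisorFunctorPf_obj (X : (CosetCat G)ᵒᵖ) (hX : IsZMonoprime (M.divisorFunctor.obj X)) :
    IsQMonoprime (M.divisorFunctorPf.obj X) :=
  isQMonoprime_perfection_of_isZMonoprime hX

/-- **Def 3.8 (i)'s clause for the split `G`-monoid `U·θ^ℕ`, AT EVERY OBJECT**: for `ρ : G →* Aut(H)`, a `ρ`-stable subgroup
`U ≤ H` and a `ρ`-fixed `θ` non-torsion modulo `U` (the shape of the stages of `Ψ_cns`, `Ψ^ι_env`, `Ψ_{†F^Θ_v,α}`), the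
perfected divisor monoid of the `G`-monoid `U·θ^ℕ` (abc-iut-w4-d019's `ofStable`) is `≅ ℚ_{≥0}` at every `G/V`
(from (B)'s «`≅ ℕ` at every object»). [cite: Mochizuki2012, Def 3.8 (i) p.113] -/
theorem isQMonoprime_divisorFunctorPf_ofStable_split {H : Type v} [CommGroup H] (ρ : G →* MulAut H) (U : Subgroup H)
    (θ : H) (hU : ∀ (g : G) (x : H), x ∈ U → ρ g x ∈ U) (hθ : ∀ g : G, ρ g θ = θ)
    (hfree : ∀ n : ℕ, θ ^ n ∈ U → n = 0) (X : (CosetCat G)ᵒᵖ) :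
    IsQMonoprime ((ofStable ρ (TemperedThetaMonoids.splitMonoid U (Submonoid.powers θ))
      (splitMonoid_stable ρ U θ hU hθ)).divisorFunctorPf.obj X) := by
  obtain ⟨d, -⟩ := exists_associates_invariants_equiv_nat ρ U θ hU hθ hfree ((unop X).sg : Subgroup G)
  exact isQMonoprime_perfection_of_isZMonoprime ⟨⟨d⟩⟩

/-! ### 3. (v2) The print-faithful data `(Φ^pf, B, Div_B ≫ (Φ → Φ^pf)^gp)`: perfect the DIVISOR monoid only -/

/-- **`Div_B` followed by `Φ^gp → (Φ^pf)^gp`**: the rational-function monoid `B = (Ψ^U)^gp` UNCHANGED, divisors read in the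
perfected divisor monoid ([FrdII] Ex 1.1 (ii) at «Λ = ℤ» with `Φ := ord(𝒪^▷)^pf`, as in [IUTchI] Ex 3.3 (i); abc-iut-L1's
`toPerfectionFunctor` whiskered with `MonGp.functor`). [cite: MochizukiFrdI2008, Prop. 5.3 p.103] -/
def divBQ : M.ratFnFunctor ⟶ monoidGp M.divisorFunctorPf :=
  M.divB ≫ Functor.whiskerRight (toPerfectionFunctor M.divisorFunctor) MonGp.functor

/-- `divBQ` on `b ∈ B(G/U)`: `ι^gp (Div_B b)`. [cite: MochizukiFrdI2008, Prop. 5.3 p.103] -/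
theorem divBQ_app (X : (CosetCat G)ᵒᵖ) (b : M.ratFnFunctor.obj X) :
    (M.divBQ.app X).hom b = gpApp (toPerfectionFunctor M.divisorFunctor) X ((M.divB.app X).hom b) := rfl

/-- **The print-faithful perfected-divisor model Frobenioid `F^ℚ(G ↷ Ψ)`**: [FrdI] Thm 5.2 (i)'s category of
`(Φ^pf, B, Div_B ≫ ι^gp)` — «a `p_v`-adic Frobenioid of monoid type `ℤ` [cf. [FrdII], Example 1.1, (ii)] … whose divisor
monoid associates to every object … a monoid isomorphic to `ℚ_{≥0}`» ([IUTchII] Def 3.8 (i), `F_cns(M^Θ_*)`), the divisor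
monoid being `Φ^pf` (objectwise `≅ ℚ_{≥0}` by §2) and the rational-function monoid the unperfected `(Ψ^U)^gp` (print's
`K^×`-type `B` at the genuine producers). [cite: Mochizuki2012, Def 3.8 (i) p.113] -/
abbrev frobenioidQ : Type (max u v) := ModelFrobenioid M.divisorFunctorPf M.ratFnFunctor M.divBQ

/-- The perfected-divisor model Frobenioid is inhabited (`(G/G, 0)`). [cite: Mochizuki2012, Def 3.8 (i) p.113] -/
theorem nonempty_frobenioidQ : Nonempty M.frobenioidQ := ⟨⟨CosetCat.top, 1⟩⟩

/-- **`(Φ, B, Div_B) → (Φ^pf, B, Div_B ≫ ι^gp)`**: `η = (Φ → Φ^pf)`, `β = 𝟙_B` (the square is an identity).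
[cite: MochizukiFrdI2008, Prop. 5.3 p.103] -/
def toQDataHom : ModelFrobenioid.DataHom M.divB M.divBQ where
  η := toPerfectionFunctor M.divisorFunctor
  β := 𝟙 M.ratFnFunctor
  comm _ _ := rfl

/-- **`F(G ↷ Ψ) ⥤ F^ℚ(G ↷ Ψ)`** (perfect the divisors, keep `B`). [cite: MochizukiFrdI2008, Prop. 5.3 p.103] -/
def toFrobenioidQ : M.frobenioid ⥤ M.frobenioidQ := M.toQDataHom.functor

/-- **`(Φ^pf, B, Div_B ≫ ι^gp) → (Φ^pf, B^pf, Div_B^pf)`**: `η = 𝟙_{Φ^pf}`, `β = (B → B^pf)`; the square commutes by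
`divPerfection_app_of` (both paths send `b` to `ι^gp (Div_B b)`). [cite: MochizukiFrdI2008, Prop. 5.3 p.103] -/
def qToPfDataHom : ModelFrobenioid.DataHom M.divBQ M.divBPf where
  η := 𝟙 M.divisorFunctorPf
  β := toPerfectionFunctor M.ratFnFunctor
  comm A u := by
    change gpApp (𝟙 M.divisorFunctorPf) A (gpApp (toPerfectionFunctor M.divisorFunctor) A ((M.divB.app A).hom u)) =
      (M.divBPf.app A).hom (Perfection.of _ u)
    rw [divBPf_app_of]
    have h1 : gpApp (𝟙 M.divisorFunctorPf) A = MonoidHom.id _ := by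
      change MonGp.map (MonoidHom.id _) = MonoidHom.id _
      exact MonGp.map_id
    rw [h1, MonoidHom.id_apply]
    rfl

/-- **`F^ℚ(G ↷ Ψ) ⥤ F^pf(G ↷ Ψ)`** (perfect `B` as well): `toFrobenioidQ ⋙ frobenioidQToPf` has the data of `toFrobenioidPf`
(`η`'s compose to `Φ → Φ^pf`, `β`'s to `B → B^pf`). [cite: MochizukiFrdI2008, Prop. 5.3 p.103] -/
def frobenioidQToPf : M.frobenioidQ ⥤ M.frobenioidPf := M.qToPfDataHom.functor

/-- `toFrobenioidQ` and `frobenioidQToPf` lie over the identity of `CosetCat G`. [cite: MochizukiFrdI2008, Prop. 5.3 p.103] -/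
theorem frobenioidQ_functors_obj_base (X : M.frobenioid) (Y : M.frobenioidQ) :
    (M.toFrobenioidQ.obj X).base = X.base ∧ (M.frobenioidQToPf.obj Y).base = Y.base := ⟨rfl, rfl⟩

/-- Def 3.8 (i)'s clause for `F^ℚ`: its divisor monoid `Φ^pf(G/U)` is `≅ ℚ_{≥0}` wherever `Φ(G/U) ≅ ℤ_{≥0}` (§2, restated
for the record that `frobenioidQ`'s divisor monoid IS `divisorFunctorPf`). [cite: Mochizuki2012, Def 3.8 (i) p.113] -/
theorem isQMonoprime_frobenioidQ_divisor_obj (X : (CosetCat G)ᵒᵖ) (hX : IsZMonoprime (M.divisorFunctor.obj X)) :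
    IsQMonoprime (M.divisorFunctorPf.obj X) :=
  M.isQMonoprime_divisorFunctorPf_obj X hX

end CoveringMonoid

end Literature.IUT.HodgeArakelov

end
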